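import Summits.CriticalPhenomena.PercolationContinuityZ3.Theorems.PercNearOneGluingNoHeavyQuantGatedSliceMixLawA5rIneq
import Summits.CriticalPhenomena.PercolationContinuityZ3.Theorems.PercNearOneGluingNoHeavyQuantGatedSliceMixLawA5Fill
import Summits.CriticalPhenomena.PercolationContinuityZ3.Theorems.PercNearOneGluingNoHeavyQuantGatedSliceMixLawA5OfPDear
import Summits.CriticalPhenomena.PercolationContinuityZ3.Theorems.PercNearOneGluingNoHeavyQuantGatedSliceMixLawPDearThin
import HarnessLib

/-!
# QUANT lane R8, T-DEC, leg (III), blob case — `LawDec.GatedSliceMixLaw'`: the regime-B P-alone cell `MixLawCellPDear` and the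
# regime-A residual cell `MixLawCellA5r` are THEOREMS

builds on p205010 (kernel theorem, internal audit signed; external expert review pending)

Support file (`--supports stmt-CriticalPhenomena-4575`), QUANT lane seat prim-quant-arm-3 (gen 116), rung R8 of
`run/shared/lean/prim/quant/LADDER.md`, task `quant/WAKE-arm-3-g33-A5R.md` (lead g33, addendum 09:20Z).  Theorems only, standard axioms,
no sorries, no definitions.

THE ARGUMENT.  Census-2/arm-2 (`…PCells`, `…KinkU1`, `…PDearThin`) reduced `MixLawCellPDear` to the kink member (I_{U₁})
`U₁(z + m₁) + U_ℓ m₁' ≤ m₂ + U₁·(1−y)/y·m₂'` on the thin regime (`decAtT_movedTwoPoint_PDear_of_kink`, `kink_member_U1'`), and (I_{U₁}) is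
the offer condition (OFF) of the lead's filling routing (`…A5Fill`) divided by `y/U₁`.  On the thin regime the low `k₁` is SMALL
(`k₁ < ag(1−z)`, from `S(k₂−k₁) < (t−2k₁)k₂`), so: if the shifted low `ℓ = k₁ + a` is heavy at `k₂`, (OFF) is the lead's
`loadBound_of_heavyShift` + `movedTwoPoint_off_of_loadBound`; if it is light, (OFF) is `movedTwoPoint_off_of_unsat` below — the mid's
UNSATURATION `(1−λ) g U_ℓ ≤ λ(1−g)` combined with the `λ`-free scalar inequality `a5r_U` of `…A5rIneq` (two Positivstellensatz certificates;
the lead's intermediate load bound (LB) being false in the corner, see that file's header).  Finally `MixLawCellA5r` is a sub-cell of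
`MixLawCellPDear` (`mixLawCellA5r_of_PDear`, lead g33).

* `LawDec.movedTwoPoint_off_of_unsat` — (OFF) for a heavy pair, a small low, the shifted low light at `k₂` and the mid unsaturated.
* `LawDec.kinkU1_of_off` — (OFF) ⟹ (I_{U₁}) (division by `y/U₁`).
* **`LawDec.mixLawCellPDear_holds : MixLawCellPDear`**, **`LawDec.mixLawCellA5r_holds : MixLawCellA5r`**.

Seat censuses (folder `work/explore/`, exact rationals): (I_{U₁}) 43 987 / 0 on `MixLawCellPDear ∩ {k₁ compatible, shortage}`; the reduced
inequality behind `a5r_U` 13 836 / 0 on the A5r corner and 0 / 3.8·10⁵ failures on its minimal 5-variable regions.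
HONEST STATUS: `MixLawCellPDear`, `MixLawCellA5r`, hence `MixLawCellA5` (`mixLawCellA5_of_residual`) are theorems; `MixLawCellQ4/QH/QK`, the other
regime-B cells, `GatedSliceMixLaw'`, CW, `GateMove`, `SingleGateConvClosed`, `TreeDEC`, `FarTreeRow` OPEN; RATE class log* / honest sentence unchanged.

[this work]; reductions: census-2 g61 / arm-2 g36 (PDear, kink member), lead g33 (A5 cells, filling routing), arm-1 g41 (routing shell).  The gluing
rows served [cite: KozmaNitzan2024, Conjecture 3 (p. 15)]; product measure [cite: Grimmett1999, §1.3 p. 10].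
-/

noncomputable section

namespace Summit.CriticalPhenomena.PercolationContinuityZ3.Theorems

namespace Quant

open Finset

/-- the two-point law `{lo, hi; g}` (as in `…QuantLawDEC`) -/
local notation3 "TP[" lo ", " hi ", " g ", " h "]" =>
  (g : ℝ) * (if (h : ℕ) = (hi : ℕ) then (1 : ℝ) else 0) + (1 - (g : ℝ)) * (if (h : ℕ) = (lo : ℕ) then (1 : ℝ) else 0)

namespace LawDec

/-! ### (OFF) for a light shifted low from unsaturation -/

set_option maxHeartbeats 800000 in
/-- **(OFF) from UNSATURATION when the shifted low is light at the mid.**  Frame numerics: `0 < y < 1`, `0 ≤ z < 1`, `g ≤ 1`,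
`y ≤ (1−z)g`, `1 ≤ a`, `0 ≤ λ ≤ 1`, the mean identity, `2(k₁+a) < t ≤ 2k₂`, `t < k₁ + k₂`, `k₂ ≤ j`, `y(k₂ + a) ≤ t`; the pair `(k₁,k₂)`
HEAVY, the low SMALL (`k₁ < ag(1−z)`), the shifted low `k₁ + a` LIGHT at `k₂` (`t − 2(k₁+a) ≤ y(k₂ − k₁ − a)`), the mid UNSATURATED
(`U_ℓ·m₁' ≤ m₂`).  Then `y(z + m₁ − (m₂ − U_ℓ m₁')/U₁) ≤ (1−y)m₂'`.  Proof: with `X = y(tqgU_ℓ + k₁p(1−g) − (t−ℓ)pg)`,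
`Y = (1−g)k₁(2k₂−t)y + gp(t − y(k₂+a))`, (OFF)·`tp` is `(1−λ)X ≤ λY` (mean identity, `U₁ = p/q`); unsaturation `(1−λ)gU_ℓ ≤ λ(1−g)` and
`a5r_U` `(1−g)X ≤ gU_ℓY` give it. [this work] -/
theorem movedTwoPoint_off_of_unsat (y z g S lam : ℝ) (a j k₁ k₂ : ℕ)
    (hy0 : 0 < y) (hy1 : y < 1) (hz0 : 0 ≤ z) (hz1 : z < 1) (hg1 : g ≤ 1) (hyg : y ≤ (1 - z) * g) (ha : 1 ≤ a)
    (hlam0 : 0 ≤ lam) (hlam1 : lam ≤ 1) (hmean : (1 - z) * ((k₁ : ℝ) + ((k₂ : ℝ) - k₁) * lam) = S)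
    (hllow : 2 * ((k₁ + a : ℕ) : ℝ) < S + (a : ℝ) * g * (1 - z)) (hk₂mid : S + (a : ℝ) * g * (1 - z) ≤ 2 * (k₂ : ℝ))
    (hcomp₁ : S + (a : ℝ) * g * (1 - z) < (k₁ : ℝ) + k₂) (hk₂j : k₂ ≤ j)
    (htaG : y * ((k₂ : ℝ) + a) ≤ S + (a : ℝ) * g * (1 - z))
    (hheavy : y * ((k₂ : ℝ) - k₁) ≤ S + (a : ℝ) * g * (1 - z) - 2 * (k₁ : ℝ))
    (hsmall : (k₁ : ℝ) < (a : ℝ) * g * (1 - z))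
    (hlight : S + (a : ℝ) * g * (1 - z) - 2 * ((k₁ + a : ℕ) : ℝ) ≤ y * ((k₂ : ℝ) - ((k₁ + a : ℕ) : ℝ)))
    (hunsat : usage y (S + (a : ℝ) * g * (1 - z)) j (k₁ + a) k₂ * ((1 - z) * (1 - lam) * g) ≤ (1 - z) * lam * (1 - g)) :
    y * (z + (1 - z) * (1 - lam) * (1 - g)
        - ((1 - z) * lam * (1 - g) - usage y (S + (a : ℝ) * g * (1 - z)) j (k₁ + a) k₂ * ((1 - z) * (1 - lam) * g))
          / usage y (S + (a : ℝ) * g * (1 - z)) j k₁ k₂) ≤ (1 - y) * ((1 - z) * lam * g) := by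
  set t : ℝ := S + (a : ℝ) * g * (1 - z) with ht
  have h1z : 0 < 1 - z := by linarith
  have h1y : 0 < 1 - y := by linarith
  have ha1 : (1 : ℝ) ≤ a := by exact_mod_cast ha
  have hk₁0 : (0 : ℝ) ≤ k₁ := Nat.cast_nonneg k₁
  have h1lam : 0 ≤ 1 - lam := by linarith
  have hg0 : 0 < g := by
    by_contra hc
    have : (1 - z) * g ≤ 0 := mul_nonpos_of_nonneg_of_nonpos h1z.le (not_lt.1 hc)
    linarith
  have ha0 : (0 : ℝ) ≤ a := Nat.cast_nonneg a
  set A : ℝ := (1 - z) * (1 - lam) * (1 - g) with hA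
  set B : ℝ := (1 - z) * (1 - lam) * g with hB
  set C : ℝ := (1 - z) * lam * (1 - g) with hC
  set D : ℝ := (1 - z) * lam * g with hD
  have hk1low : 2 * (k₁ : ℝ) < t := by push_cast at hllow; linarith
  have hllow' : 2 * ((k₁ : ℝ) + a) < t := by push_cast at hllow; linarith
  have hcompl : t < ((k₁ + a : ℕ) : ℝ) + k₂ := by push_cast; linarith
  have hlk₂ : k₁ + a < k₂ := by
    have : ((k₁ + a : ℕ) : ℝ) < k₂ := by push_cast at hcompl ⊢; linarith
    exact_mod_cast this
  -- abbreviations p = t − 2k₁ > 0, q = k₂ + k₁ − t > 0, r = t − ℓ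
  set p : ℝ := t - 2 * (k₁ : ℝ) with hp
  set q : ℝ := (k₂ : ℝ) + k₁ - t with hq
  set r : ℝ := t - ((k₁ : ℝ) + a) with hr
  have hp0 : 0 < p := by rw [hp]; linarith
  have hq0 : 0 < q := by rw [hq]; linarith
  have ht0 : 0 < t := by linarith
  -- the heavy closed form of usage(k₁,k₂) and the light closed form of usage(ℓ,k₂)
  have hU₁ : usage y t j k₁ k₂ = p / q := by
    rw [usage_eq_heavy' y t j k₁ k₂ hy0 hy1 hk₂j hk1low hcomp₁ hheavy, hp, hq]; ring_nf
  set Ul : ℝ := usage y t j (k₁ + a) k₂ with hUl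
  have hUlpos : 0 < Ul := usage_pos_of_compat y t j (k₁ + a) k₂ hy0 hy1 hllow hlk₂ (Or.inr hcompl)
  have hden0 : 0 < (1 - y) * ((1 - y) * ((k₁ : ℝ) + a) + (1 + y) * k₂ - t) := by
    apply mul_pos h1y
    have : 0 ≤ y * ((k₂ : ℝ) - k₁ - a) := mul_nonneg hy0.le (by push_cast at hcompl; linarith)
    have e : (1 - y) * ((k₁ : ℝ) + a) + (1 + y) * k₂ - t = (((k₁ : ℝ) + a) + k₂ - t) + y * ((k₂ : ℝ) - k₁ - a) := by ring
    rw [e]; push_cast at hcompl; linarith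
  have hUprod : Ul * ((1 - y) * ((1 - y) * ((k₁ : ℝ) + a) + (1 + y) * k₂ - t))
      = y ^ 2 * ((k₂ : ℝ) - k₁ - a) + (1 - y) * (t - 2 * ((k₁ : ℝ) + a)) := by
    have e := usage_eq_light' y t j (k₁ + a) k₂ hy0 hy1 hk₂j hllow hcompl hlight
    push_cast at e
    rw [hUl, e, div_mul_cancel₀ _ hden0.ne']
    ring
  -- the scalar inequality (U)
  have hyg' : y ≤ g := le_trans hyg (by linarith [mul_nonneg hz0 hg0.le])
  have hsmall' : (k₁ : ℝ) < (a : ℝ) * g := by linarith [hsmall, mul_nonneg (mul_nonneg ha0 hg0.le) hz0]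
  have hU := a5r_U (k₁ : ℝ) a k₂ t y g Ul hk₁0 (by linarith) (by push_cast at hcompl; linarith) hllow'.le
    (by push_cast at hcompl; linarith) hy0 hy1 hg1 hyg' hsmall' htaG hUprod
  -- X, Y and (1−λ)X ≤ λY
  set Xy : ℝ := y * (t * q * g * Ul + (k₁ : ℝ) * p * (1 - g) - r * p * g) with hXy
  set Yy : ℝ := (1 - g) * (k₁ : ℝ) * (2 * (k₂ : ℝ) - t) * y + g * p * (t - y * ((k₂ : ℝ) + a)) with hYy
  have hU' : (1 - g) * Xy ≤ g * Ul * Yy := by rw [hXy, hYy, hq, hp, hr]; exact hU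
  have hY0 : 0 ≤ Yy := by
    rw [hYy]
    have h1 : 0 ≤ (1 - g) * (k₁ : ℝ) * (2 * (k₂ : ℝ) - t) * y :=
      mul_nonneg (mul_nonneg (mul_nonneg (by linarith) hk₁0) (sub_nonneg.2 hk₂mid)) hy0.le
    have h2 : 0 ≤ g * p * (t - y * ((k₂ : ℝ) + a)) := mul_nonneg (mul_nonneg hg0.le hp0.le) (by linarith)
    linarith
  have hunsat' : (1 - lam) * g * Ul ≤ lam * (1 - g) := by
    have h1 : (1 - z) * ((1 - lam) * g * Ul) ≤ (1 - z) * (lam * (1 - g)) := by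
      have e1 : (1 - z) * ((1 - lam) * g * Ul) = Ul * B := by simp only [hB]; ring
      have e2 : (1 - z) * (lam * (1 - g)) = C := by simp only [hC]; ring
      rw [e1, e2]; exact hunsat
    exact le_of_mul_le_mul_left h1 h1z
  have keyE : (1 - lam) * Xy ≤ lam * Yy := by
    by_cases hX : Xy ≤ 0
    · have h1 : (1 - lam) * Xy ≤ 0 := mul_nonpos_of_nonneg_of_nonpos h1lam hX
      have h2 : 0 ≤ lam * Yy := mul_nonneg hlam0 hY0
      linarith
    · rcases eq_or_lt_of_le hg1 with hg | hg
      · -- g = 1: unsaturation forces λ = 1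
        rw [hg] at hunsat'
        have h1 : (1 - lam) * Ul ≤ 0 := by
          have : (1 - lam) * 1 * Ul ≤ lam * (1 - 1) := hunsat'
          linarith
        have h2 : 1 - lam ≤ 0 := by
          by_contra hc
          have : 0 < (1 - lam) * Ul := mul_pos (not_le.1 hc) hUlpos
          linarith
        have hl1 : lam = 1 := by linarith
        rw [hl1]; simp only [sub_self, zero_mul, one_mul]; exact hY0
      · have h1 : (1 - lam) * ((1 - g) * Xy) ≤ (1 - lam) * (g * Ul * Yy) := mul_le_mul_of_nonneg_left hU' h1lam
        have h2 : (1 - lam) * g * Ul * Yy ≤ lam * (1 - g) * Yy := mul_le_mul_of_nonneg_right hunsat' hY0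
        have h3 : (1 - g) * ((1 - lam) * Xy - lam * Yy) ≤ 0 := by linarith [h1, h2]
        have h1g : 0 < 1 - g := by linarith
        by_contra hc
        have : 0 < (1 - g) * ((1 - lam) * Xy - lam * Yy) := mul_pos h1g (by linarith [not_le.1 hc])
        linarith
  -- (OFF)·(t p) is (1−λ)X ≤ λY by the mean identity
  have key : y * (t * (p * (z + A) - q * (C - Ul * B))) ≤ (1 - y) * D * (t * p) := by
    have e : (1 - y) * D * (t * p) - y * (t * (p * (z + A) - q * (C - Ul * B))) = (1 - z) * (lam * Yy - (1 - lam) * Xy) := by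
      rw [hD, hA, hB, hC, hXy, hYy, hp, hq, hr, ht]
      linear_combination (y * (S + (a : ℝ) * g * (1 - z) - 2 * (k₁ : ℝ))) * hmean
    have : 0 ≤ (1 - z) * (lam * Yy - (1 - lam) * Xy) := mul_nonneg h1z.le (by linarith [keyE])
    linarith [e]
  -- rewrite (OFF) with U₁ = p/q and clear denominators
  rw [hU₁]
  have e2 : (C - Ul * B) / (p / q) = q * (C - Ul * B) / p := by field_simp
  rw [e2]
  have htp : 0 < t * p := mul_pos ht0 hp0
  have e5 : y * (z + A - q * (C - Ul * B) / p) = y * (t * (p * (z + A) - q * (C - Ul * B))) / (t * p) := by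
    field_simp
  rw [e5, div_le_iff₀ htp]
  exact key

/-! ### (OFF) ⟹ (I_{U₁}) -/

/-- **(OFF) ⟹ (I_{U₁})**: for `U₁ > 0` and `y > 0`, `y(z + m₁ − (m₂ − U_ℓm₁')/U₁) ≤ (1−y)m₂'` gives
`U₁(z + m₁) + U_ℓ m₁' ≤ m₂ + U₁·(1−y)/y·m₂'`. [this work] -/
theorem kinkU1_of_off (y z m₁ m₁' m₂ m₂' U₁ Ul : ℝ) (hy0 : 0 < y) (hU₁ : 0 < U₁)
    (hoff : y * (z + m₁ - (m₂ - Ul * m₁') / U₁) ≤ (1 - y) * m₂') :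
    U₁ * (z + m₁) + Ul * m₁' ≤ m₂ + U₁ * ((1 - y) / y) * m₂' := by
  have h1 : z + m₁ - (m₂ - Ul * m₁') / U₁ ≤ (1 - y) / y * m₂' := by
    rw [div_mul_eq_mul_div, le_div_iff₀ hy0]
    linarith [hoff, mul_comm y (z + m₁ - (m₂ - Ul * m₁') / U₁)]
  have h2 := mul_le_mul_of_nonneg_left h1 hU₁.le
  have e : U₁ * (z + m₁ - (m₂ - Ul * m₁') / U₁) = U₁ * (z + m₁) - (m₂ - Ul * m₁') := by field_simp
  rw [e] at h2
  have e2 : U₁ * ((1 - y) / y * m₂') = U₁ * ((1 - y) / y) * m₂' := by ring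
  linarith [h2, e2]

/-! ### The cells -/

set_option maxHeartbeats 800000 in
/-- **CELL P-DEAR IS A THEOREM.**  `decAtT_movedTwoPoint_PDear_of_kink` + `kink_member_U1'` reduce it to (I_{U₁}) on the thin regime; there
`k₁ < ag(1−z)` (from `S(k₂−k₁) < (t−2k₁)k₂`), and (I_{U₁}) is (OFF) (`kinkU1_of_off`) — by the load bound when the shifted low is heavy at
the mid (`loadBound_of_heavyShift`, `movedTwoPoint_off_of_loadBound`), by `movedTwoPoint_off_of_unsat` when it is light. [this work] -/
theorem mixLawCellPDear_holds : MixLawCellPDear := by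
  intro y z g S lam a j M k₁ k₂ hy0 hy1 hz0 hz1 hg1 hyg ha1 hjM hS0 hta hSj hSM hk hk₂M hlam0 hlam1 hmean hk₁j hk₁low hPj hPlow
    hk₂j hk₂mid hcomp hG hdear hsat
  have h1z : 0 < 1 - z := by linarith
  have hg0' : 0 < g := by
    by_contra hc
    have : (1 - z) * g ≤ 0 := mul_nonpos_of_nonneg_of_nonpos h1z.le (not_lt.1 hc)
    linarith
  have hg0 : 0 ≤ g := hg0'.le
  have ha0 : (0 : ℝ) ≤ a := Nat.cast_nonneg a
  have hk₁0 : (0 : ℝ) ≤ k₁ := Nat.cast_nonneg k₁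
  have hyk₂ : y * (k₂ : ℝ) ≤ S := le_trans (mul_le_mul_of_nonneg_left (by exact_mod_cast hk₂M) hy0.le) hta
  refine decAtT_movedTwoPoint_PDear_of_kink y z g S lam a j M k₁ k₂ hy0 hy1 hz0 hz1 hg1 hyg ha1 hjM hS0 hta hSj hSM hk hk₂M hlam0
    hlam1 hmean hk₁j hk₁low hPj hPlow hk₂j hk₂mid hcomp hG hdear hsat (fun hc1 hL => ?_)
  -- λ < 1 from the shortage (as in `mixLawCellPDear_of_thinKink`)
  have hlam1' : lam < 1 := by
    by_contra hge
    have hl1 : lam = 1 := le_antisymm hlam1 (not_lt.1 hge)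
    have hA : (1 - z) * (1 - lam) * (1 - g) = 0 := by rw [hl1]; ring
    have hL' := hL
    rw [hA, mul_zero] at hL'
    have hB : (1 - z) * (1 - lam) * g = 0 := by rw [hl1]; ring
    rw [hB, mul_zero, sub_zero] at hL'
    have : 0 ≤ (1 - z) * lam * (1 - g) := mul_nonneg (mul_nonneg h1z.le hlam0) (by linarith)
    linarith
  refine kink_member_U1' y z g S lam a j k₁ k₂ hy0 hy1 hz0 hz1 hg0 hg1 hyg hlam0 hlam1' hk₂j hyk₂ hmean hk₁low hPlow hk₂mid hcomp
    hc1 hdear (fun _ _ _ h4 => ?_)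
  -- the low is small: k₁ < ag(1−z), from h4 : S(k₂ − k₁) < (t − 2k₁)k₂
  have hSk₂ : S ≤ (k₂ : ℝ) := by
    have hkr : (k₁ : ℝ) ≤ k₂ := by exact_mod_cast hk
    have hX0 : 0 ≤ (k₁ : ℝ) + ((k₂ : ℝ) - k₁) * lam := add_nonneg hk₁0 (mul_nonneg (sub_nonneg.2 hkr) hlam0)
    have h1 : (k₁ : ℝ) + ((k₂ : ℝ) - k₁) * lam ≤ k₂ := by
      have := mul_le_of_le_one_right (sub_nonneg.2 hkr) hlam1
      linarith
    have h2 : (1 - z) * ((k₁ : ℝ) + ((k₂ : ℝ) - k₁) * lam) ≤ (k₁ : ℝ) + ((k₂ : ℝ) - k₁) * lam :=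
      mul_le_of_le_one_left hX0 (by linarith)
    linarith
  have hk₂0 : (0 : ℝ) < k₂ := by linarith
  have hsmall : (k₁ : ℝ) < (a : ℝ) * g * (1 - z) := by
    have e : (a : ℝ) * g * (1 - z) * k₂ - (k₁ : ℝ) * (2 * (k₂ : ℝ) - S)
        = (S + (a : ℝ) * g * (1 - z) - 2 * (k₁ : ℝ)) * (k₂ : ℝ) - S * ((k₂ : ℝ) - k₁) := by ring
    have h1 : (k₁ : ℝ) * (k₂ : ℝ) ≤ (k₁ : ℝ) * (2 * (k₂ : ℝ) - S) := by linarith [mul_nonneg hk₁0 (sub_nonneg.2 hSk₂)]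
    have h2 : (k₁ : ℝ) * (k₂ : ℝ) < (a : ℝ) * g * (1 - z) * k₂ := by linarith [e]
    by_contra hc
    have : (a : ℝ) * g * (1 - z) * k₂ ≤ (k₁ : ℝ) * k₂ := mul_le_mul_of_nonneg_right (not_lt.1 hc) hk₂0.le
    linarith
  have htaG : y * ((k₂ : ℝ) + a) ≤ S + (a : ℝ) * g * (1 - z) := by
    have := mul_le_mul_of_nonneg_right hyg ha0
    linarith
  have hk₁k₂ : k₁ < k₂ := by
    have : (k₁ : ℝ) < k₂ := by linarith
    exact_mod_cast this
  have hU₁pos : 0 < usage y (S + (a : ℝ) * g * (1 - z)) j k₁ k₂ :=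
    usage_pos_of_compat y _ j k₁ k₂ hy0 hy1 hk₁low hk₁k₂ (Or.inr hc1)
  refine kinkU1_of_off y z ((1 - z) * (1 - lam) * (1 - g)) ((1 - z) * (1 - lam) * g) ((1 - z) * lam * (1 - g))
    ((1 - z) * lam * g) _ _ hy0 hU₁pos ?_
  by_cases hshift : y * ((k₂ : ℝ) - ((k₁ + a : ℕ) : ℝ)) ≤ S + (a : ℝ) * g * (1 - z) - 2 * ((k₁ + a : ℕ) : ℝ)
  · -- the shifted low is heavy at k₂: the lead's load bound
    have hk₁a : k₁ ≤ a := by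
      have hgz : g * (1 - z) ≤ 1 := by
        calc g * (1 - z) ≤ 1 * (1 - z) := mul_le_mul_of_nonneg_right hg1 h1z.le
          _ ≤ 1 := by linarith
      have : (k₁ : ℝ) < a := by linarith [hsmall, mul_le_mul_of_nonneg_left hgz ha0]
      exact_mod_cast this.le
    exact movedTwoPoint_off_of_loadBound y z g S lam a j k₁ k₂ hy0 hy1 hz0 hz1 hg0' hg1 ha1 hlam0 hlam1 hmean hPlow hc1 hk₂j htaG
      hdear (loadBound_of_heavyShift y (S + (a : ℝ) * g * (1 - z)) a j k₁ k₂ hy0 hy1 hk₁a hPlow hc1 hk₂j hshift)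
  · -- the shifted low is light at k₂
    exact movedTwoPoint_off_of_unsat y z g S lam a j k₁ k₂ hy0 hy1 hz0 hz1 hg1 hyg ha1 hlam0 hlam1 hmean hPlow hk₂mid hc1 hk₂j
      htaG hdear hsmall (le_of_lt (not_le.1 hshift)) hsat

/-- **THE RESIDUAL CELL `MixLawCellA5r` IS A THEOREM** (a sub-cell of `MixLawCellPDear`, `mixLawCellA5r_of_PDear`); with it
`MixLawCellA5` (`mixLawCellA5_of_residual`, `…QuantGatedSliceMixLawA5Assembly`). [this work] -/
theorem mixLawCellA5r_holds : MixLawCellA5r :=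
  mixLawCellA5r_of_PDear mixLawCellPDear_holds

end LawDec

end Quant

end Summit.CriticalPhenomena.PercolationContinuityZ3.Theorems
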